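import Mathlib

/-!
# Boundary sets of cyclic CM types, Ia: gaps, zero windows, the potential, toggling a pair

COR-CM (cell `pub-hodgecm2`), count-neutral kernel combinatorics by the binder seat b23 (gen 38; lane CYCLIC-FACES, part Ia of
`Census/CyclicBoundaryWindows` → `Census/CyclicBoundarySlide` → `Census/CyclicBoundaryDescent` → `Census/CyclicTypeBoundary` →
`Census/CyclicFacesGenerate` → `CorCM/FaceCyclicGeneration`).  Pure combinatorics of finite subsets of `ℤ/n`; bookkeeping definitions
(`gap`, `lgap`, `zeroWindows`, `W`, `pot`) and theorems; no certificate, no `decide` table, no named fact, no geometry, no `sorry`.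
HONEST FRAMING: `HC_CM` is NOT proved, here or anywhere in the tree; nothing here is a period or a headline.

THE MODEL (dictionary in part III, `Census/CyclicTypeBoundary.lean`).  For a finite CYCLIC group `G = ⟨g⟩` of order `2n` with involution
`c = gⁿ`, an abstract CM type `Ψ ⊂ G` (`CMF G c` of the prior programme) is recorded by its BOUNDARY SET
`T(Ψ) = {k ∈ ℤ/n : exactly one of g^k, g^{k+1} lies in Ψ}` — a subset of `ℤ/n` of odd size, the same for `Ψ` and its conjugate, rotated by
base change along `g`, and changed by the flip of `Ψ` at the place of `g^j` into `T ∆ {j − 1, j}`.  This file and its sequel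
`Census/CyclicBoundarySlide.lean` develop the two quantities the face descent of part II runs on:
* `gap T t` / `lgap T t` — the distance from `t` to the next / previous member of `T` (cyclically; `n` if `T = {t}`), with the
  `Nat.find` interface (`gap_spec`, `not_mem_of_lt_gap`, `gap_le_of_mem`, `le_gap_of_forall`, and the `lgap` mirrors), and the
  predecessor-free **minimum symmetry** `le_lgap_of_forall_le_gap`: if every right gap is `≥ m`, so is every left gap;
* `W T` — the number of ZERO WINDOWS `(x; x+1, …, x+k)` (`k < n`) of `T` (= `Σ_gaps L(L−1)/2`), and the potential
  `pot T = |T|·(n²+1) + (n² − W T)`, which decreases iff `|T|` drops, or `|T|` stays and `W` grows (`pot_lt_of_card`, `pot_lt_of_W`);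
* toggling a pair `{a, b}` (the effect of a flip on a boundary set): `symmDiff_pair_of_mem_of_not_mem` & co., with the sizes;
* (sequel) the slide lemmas `W_slide_right` / `W_slide_left`: `W (T − t + (t±1)) + gap = W + lgap + 1`.
All [folklore] (elementary counting).

## References
* [Pohlmann1968] H. Pohlmann, Algebraic cycles on abelian varieties of complex multiplication type, Ann. of Math. 88 (1968), Thm 1.
-/

namespace Summit.HodgeConjecture.CorCM.Census.CyclicBoundary

open Finset

variable {n : ℕ} [NeZero n]

/-! ## §1 Small `ℤ/n` facts -/

omit [NeZero n] in
/-- A natural number strictly between `0` and `n` is nonzero in `ℤ/n`. [folklore] -/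
theorem natCast_ne_zero {m : ℕ} (h0 : 0 < m) (hn : m < n) : (m : ZMod n) ≠ 0 := by
  intro h
  rw [ZMod.natCast_eq_zero_iff] at h
  exact absurd (Nat.le_of_dvd h0 h) (not_le.mpr hn)

omit [NeZero n] in
/-- Cancelling natural offsets below `n`. [folklore] -/
theorem natCast_inj_of_lt {a b : ℕ} (ha : a < n) (hb : b < n) (h : (a : ZMod n) = b) : a = b := by
  rw [ZMod.natCast_eq_natCast_iff'] at h
  rwa [Nat.mod_eq_of_lt ha, Nat.mod_eq_of_lt hb] at h

/-- Every `s` is `t` plus a natural offset below `n`, positive if `s ≠ t`. [folklore] -/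
theorem exists_eq_add_nat (t s : ZMod n) : ∃ d : ℕ, d < n ∧ s = t + (d : ZMod n) ∧ (s ≠ t → 1 ≤ d) := by
  refine ⟨(s - t).val, ZMod.val_lt _, ?_, ?_⟩
  · rw [ZMod.natCast_zmod_val]; ring
  · intro hst
    rcases Nat.eq_zero_or_pos (s - t).val with h0 | hpos
    · exact absurd (sub_eq_zero.mp ((ZMod.val_eq_zero _).mp h0)) hst
    · exact hpos

/-- Every `s` is `t` minus a natural offset below `n`, positive if `s ≠ t`. [folklore] -/
theorem exists_eq_sub_nat (t s : ZMod n) : ∃ d : ℕ, d < n ∧ s = t - (d : ZMod n) ∧ (s ≠ t → 1 ≤ d) := by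
  refine ⟨(t - s).val, ZMod.val_lt _, ?_, ?_⟩
  · rw [ZMod.natCast_zmod_val]; ring
  · intro hst
    rcases Nat.eq_zero_or_pos (t - s).val with h0 | hpos
    · exact absurd (sub_eq_zero.mp ((ZMod.val_eq_zero _).mp h0)).symm hst
    · exact hpos

/-! ## §2 Gaps -/

open Classical in
/-- **The right gap** of `t` in `T`: the least `d ≥ 1` with `t + d ∈ T` (`n` if `T = {t}`; junk value `0` if there is none, which
does not happen for `t ∈ T`). [folklore] -/
noncomputable def gap (T : Finset (ZMod n)) (t : ZMod n) : ℕ :=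
  if h : ∃ d : ℕ, 1 ≤ d ∧ t + (d : ZMod n) ∈ T then Nat.find h else 0

open Classical in
/-- **The left gap** of `t` in `T`: the least `d ≥ 1` with `t − d ∈ T`. [folklore] -/
noncomputable def lgap (T : Finset (ZMod n)) (t : ZMod n) : ℕ :=
  if h : ∃ d : ℕ, 1 ≤ d ∧ t - (d : ZMod n) ∈ T then Nat.find h else 0

/-- A member is reached again after `n` steps. [folklore] -/
theorem exists_gap {T : Finset (ZMod n)} {t : ZMod n} (ht : t ∈ T) : ∃ d : ℕ, 1 ≤ d ∧ t + (d : ZMod n) ∈ T :=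
  ⟨n, Nat.pos_of_ne_zero (NeZero.ne n), by rw [ZMod.natCast_self, add_zero]; exact ht⟩

/-- A member is reached again after `n` steps backwards. [folklore] -/
theorem exists_lgap {T : Finset (ZMod n)} {t : ZMod n} (ht : t ∈ T) : ∃ d : ℕ, 1 ≤ d ∧ t - (d : ZMod n) ∈ T :=
  ⟨n, Nat.pos_of_ne_zero (NeZero.ne n), by rw [ZMod.natCast_self, sub_zero]; exact ht⟩

/-- **The right gap of a member**: `1 ≤ gap ≤ n` and `t + gap ∈ T`. [folklore] -/
theorem gap_spec {T : Finset (ZMod n)} {t : ZMod n} (ht : t ∈ T) :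
    1 ≤ gap T t ∧ gap T t ≤ n ∧ t + (gap T t : ZMod n) ∈ T := by
  have h := exists_gap ht
  unfold gap
  rw [dif_pos h]
  exact ⟨(Nat.find_spec h).1, Nat.find_le ⟨Nat.pos_of_ne_zero (NeZero.ne n), by rw [ZMod.natCast_self, add_zero]; exact ht⟩,
    (Nat.find_spec h).2⟩

/-- **The left gap of a member**: `1 ≤ lgap ≤ n` and `t − lgap ∈ T`. [folklore] -/
theorem lgap_spec {T : Finset (ZMod n)} {t : ZMod n} (ht : t ∈ T) :
    1 ≤ lgap T t ∧ lgap T t ≤ n ∧ t - (lgap T t : ZMod n) ∈ T := by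
  have h := exists_lgap ht
  unfold lgap
  rw [dif_pos h]
  exact ⟨(Nat.find_spec h).1, Nat.find_le ⟨Nat.pos_of_ne_zero (NeZero.ne n), by rw [ZMod.natCast_self, sub_zero]; exact ht⟩,
    (Nat.find_spec h).2⟩

omit [NeZero n] in
/-- A member at offset `d ≥ 1` bounds the right gap. [folklore] -/
theorem gap_le_of_mem {T : Finset (ZMod n)} {t : ZMod n} {d : ℕ} (hd : 1 ≤ d) (hmem : t + (d : ZMod n) ∈ T) : gap T t ≤ d := by
  have h : ∃ d : ℕ, 1 ≤ d ∧ t + (d : ZMod n) ∈ T := ⟨d, hd, hmem⟩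
  unfold gap
  rw [dif_pos h]
  exact Nat.find_le ⟨hd, hmem⟩

omit [NeZero n] in
/-- A member at offset `−d`, `d ≥ 1`, bounds the left gap. [folklore] -/
theorem lgap_le_of_mem {T : Finset (ZMod n)} {t : ZMod n} {d : ℕ} (hd : 1 ≤ d) (hmem : t - (d : ZMod n) ∈ T) : lgap T t ≤ d := by
  have h : ∃ d : ℕ, 1 ≤ d ∧ t - (d : ZMod n) ∈ T := ⟨d, hd, hmem⟩
  unfold lgap
  rw [dif_pos h]
  exact Nat.find_le ⟨hd, hmem⟩

omit [NeZero n] in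
/-- **Inside the right gap there is no member.** [folklore] -/
theorem not_mem_of_lt_gap {T : Finset (ZMod n)} {t : ZMod n} {d : ℕ} (hd : 1 ≤ d) (hlt : d < gap T t) : t + (d : ZMod n) ∉ T :=
  fun hmem => absurd (gap_le_of_mem hd hmem) (not_le.mpr hlt)

omit [NeZero n] in
/-- **Inside the left gap there is no member.** [folklore] -/
theorem not_mem_of_lt_lgap {T : Finset (ZMod n)} {t : ZMod n} {d : ℕ} (hd : 1 ≤ d) (hlt : d < lgap T t) : t - (d : ZMod n) ∉ T :=
  fun hmem => absurd (lgap_le_of_mem hd hmem) (not_le.mpr hlt)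

/-- A run of `m − 1` non-members after a member forces `gap ≥ m`. [folklore] -/
theorem le_gap_of_forall {T : Finset (ZMod n)} {t : ZMod n} (ht : t ∈ T) {m : ℕ}
    (h : ∀ d : ℕ, 1 ≤ d → d < m → t + (d : ZMod n) ∉ T) : m ≤ gap T t := by
  by_contra hlt
  exact h (gap T t) (gap_spec ht).1 (not_le.mp hlt) (gap_spec ht).2.2

/-- A run of `m − 1` non-members before a member forces `lgap ≥ m`. [folklore] -/
theorem le_lgap_of_forall {T : Finset (ZMod n)} {t : ZMod n} (ht : t ∈ T) {m : ℕ}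
    (h : ∀ d : ℕ, 1 ≤ d → d < m → t - (d : ZMod n) ∉ T) : m ≤ lgap T t := by
  by_contra hlt
  exact h (lgap T t) (lgap_spec ht).1 (not_le.mp hlt) (lgap_spec ht).2.2

omit [NeZero n] in
/-- A set with two members has a member other than any given one. [folklore] -/
theorem exists_mem_ne {T : Finset (ZMod n)} (h2 : 2 ≤ T.card) (t : ZMod n) : ∃ s ∈ T, s ≠ t := by
  by_contra hno
  push Not at hno
  have hsub : T ⊆ {t} := fun s hs => Finset.mem_singleton.mpr (hno s hs)
  have := Finset.card_le_card hsub
  rw [Finset.card_singleton] at this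
  omega

/-- With a second member the right gap is `< n`. [folklore] -/
theorem gap_lt_of_two_le {T : Finset (ZMod n)} (h2 : 2 ≤ T.card) {t : ZMod n} : gap T t < n := by
  obtain ⟨s, hs, hst⟩ := exists_mem_ne h2 t
  obtain ⟨d, hdn, hsd, hd1⟩ := exists_eq_add_nat t s
  rw [hsd] at hs
  exact lt_of_le_of_lt (gap_le_of_mem (hd1 hst) hs) hdn

/-- With a second member the left gap is `< n`. [folklore] -/
theorem lgap_lt_of_two_le {T : Finset (ZMod n)} (h2 : 2 ≤ T.card) {t : ZMod n} : lgap T t < n := by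
  obtain ⟨s, hs, hst⟩ := exists_mem_ne h2 t
  obtain ⟨d, hdn, hsd, hd1⟩ := exists_eq_sub_nat t s
  rw [hsd] at hs
  exact lt_of_le_of_lt (lgap_le_of_mem (hd1 hst) hs) hdn

/-- **Minimum symmetry**: if every right gap is `≥ m`, so is every left gap (the left gap of `t` is the right gap of its predecessor —
stated without predecessors). [folklore] -/
theorem le_lgap_of_forall_le_gap {T : Finset (ZMod n)} {m : ℕ} (h : ∀ v ∈ T, m ≤ gap T v) {t : ZMod n} (ht : t ∈ T) :
    m ≤ lgap T t := by
  refine le_lgap_of_forall ht fun d hd1 hdm hmem => ?_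
  have key := not_mem_of_lt_gap (t := t - (d : ZMod n)) hd1 (lt_of_lt_of_le hdm (h _ hmem))
  rw [sub_add_cancel] at key
  exact key ht

/-! ## §3 Zero windows and the potential -/

/-- **The zero windows** of `T`: pairs `(x, k)`, `k < n`, with `x, x + 1, …, x + k ∉ T`. [folklore] -/
def zeroWindows (T : Finset (ZMod n)) : Finset (ZMod n × ℕ) :=
  ((Finset.univ : Finset (ZMod n)) ×ˢ Finset.range n).filter
    fun w : ZMod n × ℕ => ∀ e ∈ Finset.range (w.2 + 1), w.1 + (e : ZMod n) ∉ T

/-- **The window count** `W T = #zeroWindows T` (`= Σ_gaps L(L−1)/2`). [folklore] -/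
def W (T : Finset (ZMod n)) : ℕ := (zeroWindows T).card

/-- Membership in `zeroWindows`. [folklore] -/
theorem mem_zeroWindows {T : Finset (ZMod n)} {x : ZMod n} {k : ℕ} :
    (x, k) ∈ zeroWindows T ↔ k < n ∧ ∀ e : ℕ, e ≤ k → x + (e : ZMod n) ∉ T := by
  unfold zeroWindows
  simp only [Finset.mem_filter, Finset.mem_product, Finset.mem_univ, true_and, Finset.mem_range, Nat.lt_succ_iff]

/-- `W T ≤ n²`. [folklore] -/
theorem W_le (T : Finset (ZMod n)) : W T ≤ n * n := by
  unfold W zeroWindows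
  refine (Finset.card_filter_le _ _).trans ?_
  rw [Finset.card_product, Finset.card_univ, ZMod.card, Finset.card_range]

/-- **The potential** `pot T = |T|·(n²+1) + (n² − W T)`: lexicographic in (`|T|` ascending, `W` descending). [folklore] -/
def pot (T : Finset (ZMod n)) : ℕ := T.card * (n * n + 1) + (n * n - W T)

/-- **The potential drops when two members are lost.** [folklore] -/
theorem pot_lt_of_card {T T' : Finset (ZMod n)} (h : T'.card + 2 ≤ T.card) : pot T' < pot T := by
  unfold pot
  have h1 : W T' ≤ n * n := W_le T'
  have h2 : T'.card * (n * n + 1) + 2 * (n * n + 1) ≤ T.card * (n * n + 1) := by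
    have := Nat.mul_le_mul_right (n * n + 1) h
    rwa [Nat.add_mul] at this
  generalize n * n = N at *
  generalize T'.card * (N + 1) = A' at *
  generalize T.card * (N + 1) = A at *
  omega

/-- **The potential drops when the size stays and the window count grows.** [folklore] -/
theorem pot_lt_of_W {T T' : Finset (ZMod n)} (hc : T'.card = T.card) (hW : W T < W T') : pot T' < pot T := by
  unfold pot
  have h1 : W T' ≤ n * n := W_le T'
  rw [hc]
  generalize n * n = N at *
  generalize T.card * (N + 1) = A at *
  omega

/-! ## §4 Toggling a pair -/

open scoped symmDiff

omit [NeZero n] in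
/-- Toggling a member and a non-member: erase the one, insert the other. [folklore] -/
theorem symmDiff_pair_of_mem_of_not_mem {T : Finset (ZMod n)} {a b : ZMod n} (ha : a ∈ T) (hb : b ∉ T) :
    T ∆ {a, b} = insert b (T.erase a) := by
  have hab : a ≠ b := fun h => hb (h ▸ ha)
  ext x
  simp only [Finset.mem_symmDiff, Finset.mem_insert, Finset.mem_erase, Finset.mem_singleton]
  by_cases hxa : x = a
  · rw [hxa]; simp [ha, hab]
  · by_cases hxb : x = b
    · rw [hxb]; simp [hb]
    · simp [hxa, hxb]

omit [NeZero n] in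
/-- Toggling a non-member and a member. [folklore] -/
theorem symmDiff_pair_of_not_mem_of_mem {T : Finset (ZMod n)} {a b : ZMod n} (ha : a ∉ T) (hb : b ∈ T) :
    T ∆ {a, b} = insert a (T.erase b) := by
  rw [Finset.pair_comm]
  exact symmDiff_pair_of_mem_of_not_mem hb ha

omit [NeZero n] in
/-- Toggling two members: erase both. [folklore] -/
theorem symmDiff_pair_of_mem_of_mem {T : Finset (ZMod n)} {a b : ZMod n} (ha : a ∈ T) (hb : b ∈ T) :
    T ∆ {a, b} = (T.erase a).erase b := by
  ext x
  simp only [Finset.mem_symmDiff, Finset.mem_insert, Finset.mem_erase, Finset.mem_singleton]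
  by_cases hxa : x = a
  · rw [hxa]; simp [ha]
  · by_cases hxb : x = b
    · rw [hxb]; simp [hb]
    · simp [hxa, hxb]

omit [NeZero n] in
/-- The size after toggling a member and a non-member. [folklore] -/
theorem card_insert_erase {T : Finset (ZMod n)} {a b : ZMod n} (ha : a ∈ T) (hb : b ∉ T) :
    (insert b (T.erase a)).card = T.card := by
  have hb' : b ∉ T.erase a := fun h => hb (Finset.mem_of_mem_erase h)
  rw [Finset.card_insert_of_notMem hb', Finset.card_erase_of_mem ha]
  have := Finset.card_pos.mpr ⟨a, ha⟩
  omega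

omit [NeZero n] in
/-- The size after toggling two distinct members. [folklore] -/
theorem card_erase_erase {T : Finset (ZMod n)} {a b : ZMod n} (ha : a ∈ T) (hb : b ∈ T) (hab : a ≠ b) :
    ((T.erase a).erase b).card + 2 = T.card := by
  have hb' : b ∈ T.erase a := Finset.mem_erase.mpr ⟨hab.symm, hb⟩
  rw [Finset.card_erase_of_mem hb', Finset.card_erase_of_mem ha]
  have : 2 ≤ T.card := by
    have hsub : ({a, b} : Finset (ZMod n)) ⊆ T := by
      intro x hx
      rw [Finset.mem_insert, Finset.mem_singleton] at hx
      rcases hx with rfl | rfl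
      · exact ha
      · exact hb
    have := Finset.card_le_card hsub
    rwa [Finset.card_pair hab] at this
  omega

end Summit.HodgeConjecture.CorCM.Census.CyclicBoundary
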